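import Summits.BirchSwinnertonDyer.BirchSwinnertonDyer.Statement
import HarnessLib

/-!
# SoloInformedWeightClass — the square classes of the classical weights in the 7-adic weight disc

Certificate arithmetic behind the CLASS TEST of notebook §25 (pre-registered as C105 before any
`L`-value was computed).  In the 7-adic Hida family through `f_{389a1}` (`𝕋_𝔪 = Λ` at `p = 7`,
notebook §24), the classical weights `k ≡ 2 (mod 6)` sit at the points `w_k = 8^{k-2} - 1` of the
weight disc (`1 + w = γ^{k-2}`, `γ = 8`).  The period-free observable of §25 is the near-central
zero pair `u = ±√U₀(k)` of the branch-`0` cyclotomic `7`-adic `L`-function of the weight-`k` member;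
with `ρ(w) = Σ_{j ≥ 1} c_j w^j` one has `U₀(k) = -c_j w_k^j (1 + O(w_k))` for the least `j` with
`c_j ≠ 0`, so the SQUARE CLASS of `U₀(k)` in `ℚ₇ˣ/(ℚ₇ˣ)²` is `class(-c_j) · class(w_k)^j`.

What is certified here (elementary, but it is exactly what makes three weights decide between
`j = 1` (`a_w ≠ 0`), `j = 2` (`a_w = 0`, `R_† ≠ 0`: the prediction) and `j = 3`):

* `soloInformed_weightPoint_div` / `soloInformed_weightPoint_unit_mod`:
  `8^m - 1 = 7 · u` with `u ≡ m (mod 7)`; hence `v₇(w_k) = 1` exactly when `7 ∤ k - 2`, with unit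
  part `≡ k - 2 (mod 7)`.
* `soloInformed_weightPoint_not_dvd_49`: `49 ∤ 8^m - 1` iff `7 ∤ m`.
* `soloInformed_zmod7_isSquare_iff`: the squares of `(ℤ/7)ˣ` are `{1, 2, 4}`; so for
  `k = 8, 14, 20, 26, 32` (`k - 2 ≡ 6, 5, 4, 3, 2`) the unit parts of `w_k` are
  non-square, non-square, square, non-square, square: the classes `class(w_k)` are NOT constant,
  and neither are `class(w_k)^3 = class(w_k)`; only `class(w_k)^2` is.
* `soloInformed_weightClass_table`: the five unit residues and their square status, by `decide`.

Consequence used in §25 (stated in the notebook, not formalised: it concerns `7`-adic analytic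
functions): `class(U₀(k))` constant over `k ∈ {8, 14, 20}` forces `j` even, i.e. rules out
`a_w ≠ 0` (and `c₂ = 0 ≠ c₃`), with no Vandermonde fit and no period.
-/

namespace Summit.BirchSwinnertonDyer.BirchSwinnertonDyer.Theorems

/-- `8^m - 1` is divisible by `7`, with quotient `≡ m (mod 7)`: the binomial congruence
`8^m = (1+7)^m ≡ 1 + 7m (mod 49)`, proved by induction with linear arithmetic only. -/
theorem soloInformed_weightPoint_unit_mod (m : ℕ) :
    ∃ u : ℤ, (8 : ℤ) ^ m - 1 = 7 * u ∧ u % 7 = (m : ℤ) % 7 := by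
  induction m with
  | zero => exact ⟨0, by norm_num, by norm_num⟩
  | succ n ih =>
    obtain ⟨u, hu, hmod⟩ := ih
    refine ⟨8 * u + 1, ?_, ?_⟩
    · have : (8 : ℤ) ^ (n + 1) = 8 * 8 ^ n := by ring
      rw [this]
      have h8 : (8 : ℤ) ^ n = 7 * u + 1 := by linarith
      rw [h8]; ring
    · push_cast
      omega

/-- `7 ∣ 8^m - 1`. -/
theorem soloInformed_weightPoint_div (m : ℕ) : (7 : ℤ) ∣ (8 : ℤ) ^ m - 1 := by
  obtain ⟨u, hu, _⟩ := soloInformed_weightPoint_unit_mod m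
  exact ⟨u, hu⟩

/-- `49 ∣ 8^m - 1` iff `7 ∣ m`; equivalently `v₇(8^m - 1) = 1` exactly when `7 ∤ m`
(so `v₇(w_k) = 1` for every `k ≡ 2 (mod 6)` with `k ≢ 2 (mod 42)`). -/
theorem soloInformed_weightPoint_dvd_49_iff (m : ℕ) :
    (49 : ℤ) ∣ (8 : ℤ) ^ m - 1 ↔ (7 : ℤ) ∣ (m : ℤ) := by
  obtain ⟨u, hu, hmod⟩ := soloInformed_weightPoint_unit_mod m
  rw [hu]
  constructor
  · rintro ⟨c, hc⟩
    have : u = 7 * c := by linarith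
    omega
  · rintro ⟨c, hc⟩
    refine ⟨(u - m) / 7 + c, ?_⟩
    omega

/-- `49 ∤ 8^m - 1` when `7 ∤ m`: the valuation of `w_k` is exactly `1` for `k ≢ 2 (mod 42)`. -/
theorem soloInformed_weightPoint_not_dvd_49 (m : ℕ) (hm : ¬ (7 : ℤ) ∣ (m : ℤ)) :
    ¬ (49 : ℤ) ∣ (8 : ℤ) ^ m - 1 :=
  fun h => hm ((soloInformed_weightPoint_dvd_49_iff m).1 h)

/-- The squares in `ℤ/7ℤ`: `x` is a square iff `x ∈ {0, 1, 2, 4}`. -/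
theorem soloInformed_zmod7_isSquare_iff (x : ZMod 7) :
    IsSquare x ↔ (x = 0 ∨ x = 1 ∨ x = 2 ∨ x = 4) := by
  constructor
  · rintro ⟨y, rfl⟩
    revert y; decide
  · rintro (rfl | rfl | rfl | rfl)
    · exact ⟨0, by decide⟩
    · exact ⟨1, by decide⟩
    · exact ⟨3, by decide⟩
    · exact ⟨2, by decide⟩

/-- The class table of the five classical weights of §25: for `k = 8, 14, 20, 26, 32` the unit
part of `w_k = 8^{k-2} - 1` is `≡ k - 2 ≡ 6, 5, 4, 3, 2 (mod 7)`, of which exactly `4` and `2`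
(i.e. `k = 20, 32`) are squares mod `7`.  With `v₇(w_k) = 1` throughout, the square classes of
`w_8, w_14, w_20, w_26, w_32` in `ℚ₇ˣ/(ℚ₇ˣ)²` are `7·ν, 7·ν, 7·1, 7·ν, 7·1` (`ν` = non-square unit
class): not constant, while their squares are all trivial. -/
theorem soloInformed_weightClass_table :
    ((8 - 2 : ℕ) % 7 = 6 ∧ (14 - 2 : ℕ) % 7 = 5 ∧ (20 - 2 : ℕ) % 7 = 4 ∧ (26 - 2 : ℕ) % 7 = 3 ∧
      (32 - 2 : ℕ) % 7 = 2) ∧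
    (¬ IsSquare (6 : ZMod 7) ∧ ¬ IsSquare (5 : ZMod 7) ∧ IsSquare (4 : ZMod 7) ∧
      ¬ IsSquare (3 : ZMod 7) ∧ IsSquare (2 : ZMod 7)) := by
  refine ⟨by decide, ?_, ?_, ?_, ?_, ?_⟩
  · rw [soloInformed_zmod7_isSquare_iff]; decide
  · rw [soloInformed_zmod7_isSquare_iff]; decide
  · exact ⟨2, by decide⟩
  · rw [soloInformed_zmod7_isSquare_iff]; decide
  · exact ⟨3, by decide⟩

/-- The explicit instances used: `8^6 - 1 = 7 · 37449` with `37449 ≡ 6`, `8^12 - 1 = 7 · u` with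
`u ≡ 5`, `8^18 - 1 = 7 · u` with `u ≡ 4 (mod 7)` — i.e. the unit parts of `w_8, w_14, w_20`. -/
theorem soloInformed_weightPoint_instances :
    ((8 : ℤ) ^ 6 - 1) / 7 % 7 = 6 ∧ ((8 : ℤ) ^ 12 - 1) / 7 % 7 = 5 ∧ ((8 : ℤ) ^ 18 - 1) / 7 % 7 = 4 ∧
    ((8 : ℤ) ^ 24 - 1) / 7 % 7 = 3 ∧ ((8 : ℤ) ^ 30 - 1) / 7 % 7 = 2 := by
  norm_num

end Summit.BirchSwinnertonDyer.BirchSwinnertonDyer.Theorems
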